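import Summits.Ventures.HSemireg.WedgeHankelRecurrenceGaussLaguerreDiscriminant

/-!
# Venture HSemireg — **THE DISCRIMINANT OF THE ULTRASPHERICAL (GEGENBAUER) AND LEGENDRE POLYNOMIALS** (monic recurrence `a ≡ 0`, `b_{n+1} = (n+1)(n+2λ)∕(4(n+1+λ)(n+λ))`, `λ > 0`):
# by SCHUR's method (N404) with the structure relation `(X² − 1) q_{n+1}′ = (n+1) X q_{n+1} − c_n q_n`, `c_n = (n+1)(n+2λ)∕(2(n+λ))` (N392), `Res(q_{n+1}, X² − 1) = q_{n+1}(1) q_{n+1}(−1)` and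
# the parity `q_{n+1}(−1) = (−1)^{n+1} q_{n+1}(1)`: **`q_{n+1}(1)² · disc(q_{n+1}) = c_n^{n+1} ∏_{k<n} b_{k+1}^{k+1}`** with the explicit value **`q_n(1) = ∏_{k<n} (k+2λ)∕(2(k+λ))`**;
# the LEGENDRE case `λ = ½` (`b_{n+1} = (n+1)²∕(4(n+1)²−1)`, `q_n(1) = ∏ (k+1)∕(2k+1)`, `c_n = (n+1)²∕(2n+1)`) and the value of `∏_{i<j}(x_j − x_i)²` at the zeros

HONEST FRAMING. Part of the Lean index of the computation cell `pub-hsemireg` (seat p10 gen 47, Sunday typer «UNIFORM-IN-n»).  Polynomial algebra over `ℝ` (Mathlib `Polynomial.resultant ∕ discr`) and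
rational identities only; no variety, no cohomology theory, no sheaf, no Ext group and no semiregularity map is constructed here; nothing here says that HC / HC_CM / HC_AV holds; no Literature
fact (unproved `Prop`) is declared or used.  Custodian versions as in `WedgeHankelSiegelIdeal` (1/3).
SOURCES (cited).  T. J. Stieltjes, *Sur les polynômes de Jacobi*, C. R. Acad. Sci. Paris 100 (1885) 620–622; D. Hilbert, J. reine angew. Math. 103 (1888) 337–345; I. Schur, J. reine angew. Math. 165
(1931) 52–58, §2; G. Szegő, *Orthogonal Polynomials*, Thm 6.71, eq. (6.71.5) (Jacobi ∕ ultraspherical discriminant) and (4.7.3) (`P_n^{(λ)}(1) = (2λ)_n∕n!`, leading coefficient `2^n (λ)_n∕n!`, so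
the monic value at `1` is `(2λ)_n ∕ (2^n (λ)_n) = ∏_{k<n} (k+2λ)∕(2(k+λ))`).
PROOF TYPED HERE.  The product identity is EXACT (no closed form of Szegő's type is asserted): N404 `resultant_mul_discr_recurrence` with `π = X² − 1`, `d = 2`, `A = (n+1) X`, `c = −c_n`; `Res_{(m,2)}(f,
X² − 1) = f(1) f(−1)` from N407 `resultant_one_sub_X_sq`; parity of a recurrence with zero diagonal by a two-step induction; `q_n(1)` by a two-step induction (`b_{n+1} = r_n (1 − r_{n+1})`,
`r_k = (k+2λ)∕(2(k+λ))`); the two signs `(−1)^{n+1}` cancel.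
DEDUP DISCLOSURE (`rg -n -i 'gegenbauer.*discr|legendre.*discr|eval_one|eval_neg_one' Summits/Ventures/HSemireg/WedgeHankelRecurrenceGauss*`, 2026-09-04): N390 ∕ N392 ∕ N394 ∕ N398 (zeros, structure
relation, square sums, sum rules) — no value at `±1` and no discriminant; 0 hits for the 8 names below.

WHAT IS IN THE TREE.  N404 `resultant_mul_discr_recurrence`; N407 `resultant_one_sub_X_sq`; N392 `gegenbauer_structure_relation`; N390 `gegenbauer_zeros`; N653-block `discr_prod_X_sub_C`.
THIS FILE (namespace `Summit.Ventures.HSemireg.Wedge.HankelOuter` continued; CHAINED on N408 (import only); 0 definitions):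
* §1174 `resultant_X_sq_sub_one` (`Res_{(m,2)}(f, X² − 1) = f(1) f(−1)`), `recurrence_eval_neg_of_diag_zero` (`a ≡ 0 ⇒ q_n(−s) = (−1)^n q_n(s)`), **`gegenbauer_eval_one`** (`q_n(1) = ∏_{k<n} (k+2λ)∕(2(k+λ))`),
  **`gegenbauer_discr_mul`** (`q_{n+1}(1)² disc q_{n+1} = c_n^{n+1} ∏ b_{k+1}^{k+1}`), `gegenbauer_discr` (divided form), **`gegenbauer_zeros_discr`** (`(∏_{i<j}(x_j − x_i))²`), `legendre_eval_one`
  (`q_n(1) = ∏ (k+1)∕(2k+1)`), **`legendre_discr_mul`** (`(∏_{k ≤ n} (k+1)∕(2k+1))² disc P̃_{n+1} = ((n+1)²∕(2n+1))^{n+1} ∏_{k<n} ((k+1)²∕(4(k+1)²−1))^{k+1}`).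
CAVEATS.  `λ > 0` as in N390 ∕ N392 (the range `−½ < λ ≤ 0`, Chebyshev-`T` at `λ = 0`, is N407's separate computation); monic normalisation.  Nothing Ext-side.  New names only.
-/

open Module Polynomial
open scoped Matrix Polynomial

namespace Summit.Ventures.HSemireg.Wedge.HankelOuter

/-! ## §1174. Gegenbauer and Legendre discriminants -/

/-- `Res_{(m,2)}(f, X² − 1) = f(1) · f(−1)` (`deg f ≤ m`, nontrivial commutative ring). [this file, §1174] -/
theorem resultant_X_sq_sub_one {R : Type*} [CommRing R] [Nontrivial R] {f : R[X]} {m : ℕ} (hf : f.natDegree ≤ m) :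
    f.resultant (Polynomial.X ^ 2 - 1) m 2 = f.eval 1 * f.eval (-1) := by
  rw [show (Polynomial.X ^ 2 - 1 : R[X]) = C (-1 : R) * (1 - Polynomial.X ^ 2) by simp only [map_neg, map_one]; ring, resultant_C_mul_right, resultant_one_sub_X_sq hf]
  have hsq : ((-1 : R) ^ m) * ((-1 : R) ^ m) = 1 := by rw [← pow_add, ← two_mul, pow_mul, neg_one_sq, one_pow]
  linear_combination (f.eval 1 * f.eval (-1)) * hsq

/-- **PARITY: for a zero diagonal `a ≡ 0`, `q_n(−s) = (−1)^n q_n(s)`.** [Szegő (4.7.4); Chihara I §8; this file, §1174] -/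
theorem recurrence_eval_neg_of_diag_zero {q : ℕ → ℝ[X]} {a b : ℕ → ℝ} (hq0 : q 0 = 1) (hq1 : q 1 = Polynomial.X - C (a 0))
    (hrec : ∀ n, q (n + 2) = (Polynomial.X - C (a (n + 1))) * q (n + 1) - C (b (n + 1)) * q n) (ha : ∀ n, a n = 0) (s : ℝ) (n : ℕ) :
    (q n).eval (-s) = (-1) ^ n * (q n).eval s := by
  have key : ∀ n, (q n).eval (-s) = (-1) ^ n * (q n).eval s ∧ (q (n + 1)).eval (-s) = (-1) ^ (n + 1) * (q (n + 1)).eval s := by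
    intro n
    induction n with
    | zero =>
      refine ⟨by rw [hq0, eval_one, eval_one, pow_zero, one_mul], ?_⟩
      rw [zero_add, hq1, ha]; simp
    | succ n ih =>
      refine ⟨ih.2, ?_⟩
      rw [show n + 1 + 1 = n + 2 from rfl, hrec n, ha]
      simp only [eval_sub, eval_mul, eval_X, eval_C, map_zero, sub_zero, ih.1, ih.2]
      ring
  exact (key n).1

/-- **THE MONIC GEGENBAUER VALUE AT `1`: `q_n(1) = ∏_{k<n} (k + 2λ) ∕ (2(k + λ))`** (`λ > 0`). [Szegő (4.7.3) with the leading coefficient (4.7.9); this file, §1174] -/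
theorem gegenbauer_eval_one {q : ℕ → ℝ[X]} {a b : ℕ → ℝ} {lam : ℝ} (hq0 : q 0 = 1) (hq1 : q 1 = Polynomial.X - C (a 0))
    (hrec : ∀ n, q (n + 2) = (Polynomial.X - C (a (n + 1))) * q (n + 1) - C (b (n + 1)) * q n) (ha : ∀ n, a n = 0)
    (hb : ∀ n, b (n + 1) = ((n : ℝ) + 1) * ((n : ℝ) + 2 * lam) / (4 * ((n : ℝ) + 1 + lam) * ((n : ℝ) + lam))) (hlam : 0 < lam) (n : ℕ) :
    (q n).eval 1 = ∏ k ∈ Finset.range n, ((k : ℝ) + 2 * lam) / (2 * ((k : ℝ) + lam)) := by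
  have key : ∀ n, (q n).eval 1 = ∏ k ∈ Finset.range n, ((k : ℝ) + 2 * lam) / (2 * ((k : ℝ) + lam)) ∧
      (q (n + 1)).eval 1 = ∏ k ∈ Finset.range (n + 1), ((k : ℝ) + 2 * lam) / (2 * ((k : ℝ) + lam)) := by
    intro n
    induction n with
    | zero =>
      refine ⟨by rw [hq0, eval_one, Finset.prod_range_zero], ?_⟩
      rw [zero_add, hq1, ha, Finset.prod_range_one, eval_sub, eval_X, eval_C, sub_zero, Nat.cast_zero, zero_add, zero_add]
      have h : 2 * lam ≠ 0 := by positivity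
      rw [div_self h]
    | succ n ih =>
      refine ⟨ih.2, ?_⟩
      rw [show n + 1 + 1 = n + 2 from rfl, hrec n, ha, eval_sub, eval_mul, eval_sub, eval_X, eval_C, sub_zero, one_mul, eval_mul, eval_C, ih.1, ih.2, hb n,
        Finset.prod_range_succ _ (n + 1), Finset.prod_range_succ _ n]
      have h0 : (0 : ℝ) ≤ n := Nat.cast_nonneg n
      have h1 : 2 * ((n : ℝ) + lam) ≠ 0 := by positivity
      have h2 : 2 * (((n + 1 : ℕ) : ℝ) + lam) ≠ 0 := by positivity
      have h3 : 4 * ((n : ℝ) + 1 + lam) * ((n : ℝ) + lam) ≠ 0 := by positivity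
      push_cast
      field_simp
      ring
  exact (key n).1

/-- **GEGENBAUER: `q_{n+1}(1)² · disc(q_{n+1}) = c_n^{n+1} ∏_{k<n} b_{k+1}^{k+1}`, `c_n = (n+1)(n+2λ)∕(2(n+λ))`** (`λ > 0`). [Stieltjes 1885; Hilbert 1888; Schur 1931 §2; Szegő (6.71.5); this file,
§1174] -/
theorem gegenbauer_discr_mul {q : ℕ → ℝ[X]} {a b : ℕ → ℝ} {lam : ℝ} (hq0 : q 0 = 1) (hq1 : q 1 = Polynomial.X - C (a 0))
    (hrec : ∀ n, q (n + 2) = (Polynomial.X - C (a (n + 1))) * q (n + 1) - C (b (n + 1)) * q n) (ha : ∀ n, a n = 0)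
    (hb : ∀ n, b (n + 1) = ((n : ℝ) + 1) * ((n : ℝ) + 2 * lam) / (4 * ((n : ℝ) + 1 + lam) * ((n : ℝ) + lam))) (hlam : 0 < lam) (n : ℕ) :
    ((q (n + 1)).eval 1) ^ 2 * (q (n + 1)).discr =
      (((n : ℝ) + 1) * ((n : ℝ) + 2 * lam) / (2 * ((n : ℝ) + lam))) ^ (n + 1) * ∏ k ∈ Finset.range n, b (k + 1) ^ (k + 1) := by
  obtain ⟨hd, -⟩ := recurrence_natDegree_le_coeff hq0 hq1 hrec (n + 1)
  have hlow : (Polynomial.X ^ 2 - 1) * derivative (q (n + 1)) =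
      (C ((n : ℝ) + 1) * Polynomial.X) * q (n + 1) + C (-(((n : ℝ) + 1) * ((n : ℝ) + 2 * lam) / (2 * ((n : ℝ) + lam)))) * q n := by
    rw [gegenbauer_structure_relation hq0 hq1 hrec ha hb hlam n, map_neg]; ring
  have hπ : (Polynomial.X ^ 2 - 1 : ℝ[X]).natDegree ≤ 2 :=
    (natDegree_sub_le _ _).trans (max_le (natDegree_pow_le_of_le 2 natDegree_X_le) (by rw [natDegree_one]; omega))
  have hA : (C ((n : ℝ) + 1) * Polynomial.X).natDegree + 1 ≤ 2 := by have := (natDegree_C_mul_le ((n : ℝ) + 1) Polynomial.X).trans natDegree_X_le; omega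
  have h := resultant_mul_discr_recurrence hq0 hq1 hrec hπ hA hlow
  rw [resultant_X_sq_sub_one hd, recurrence_eval_neg_of_diag_zero hq0 hq1 hrec ha 1 (n + 1), neg_pow (((n : ℝ) + 1) * ((n : ℝ) + 2 * lam) / (2 * ((n : ℝ) + lam))) (n + 1)] at h
  have hsq : ((-1 : ℝ) ^ (n + 1)) * ((-1 : ℝ) ^ (n + 1)) = 1 := by rw [← pow_add, ← two_mul, pow_mul, neg_one_sq, one_pow]
  linear_combination ((-1 : ℝ) ^ (n + 1)) * h +
    ((((n : ℝ) + 1) * ((n : ℝ) + 2 * lam) / (2 * ((n : ℝ) + lam))) ^ (n + 1) * ∏ k ∈ Finset.range n, b (k + 1) ^ (k + 1) - ((q (n + 1)).eval 1) ^ 2 * (q (n + 1)).discr) * hsq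

/-- The divided form: **`disc(q_{n+1}) = c_n^{n+1} ∏_{k<n} b_{k+1}^{k+1} ∕ (∏_{k ≤ n} (k+2λ)∕(2(k+λ)))²`** (`λ > 0`). [Szegő (6.71.5); this file, §1174] -/
theorem gegenbauer_discr {q : ℕ → ℝ[X]} {a b : ℕ → ℝ} {lam : ℝ} (hq0 : q 0 = 1) (hq1 : q 1 = Polynomial.X - C (a 0))
    (hrec : ∀ n, q (n + 2) = (Polynomial.X - C (a (n + 1))) * q (n + 1) - C (b (n + 1)) * q n) (ha : ∀ n, a n = 0)
    (hb : ∀ n, b (n + 1) = ((n : ℝ) + 1) * ((n : ℝ) + 2 * lam) / (4 * ((n : ℝ) + 1 + lam) * ((n : ℝ) + lam))) (hlam : 0 < lam) (n : ℕ) :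
    (q (n + 1)).discr = (((n : ℝ) + 1) * ((n : ℝ) + 2 * lam) / (2 * ((n : ℝ) + lam))) ^ (n + 1) * (∏ k ∈ Finset.range n, b (k + 1) ^ (k + 1)) /
      (∏ k ∈ Finset.range (n + 1), ((k : ℝ) + 2 * lam) / (2 * ((k : ℝ) + lam))) ^ 2 := by
  have hpos : 0 < ∏ k ∈ Finset.range (n + 1), ((k : ℝ) + 2 * lam) / (2 * ((k : ℝ) + lam)) :=
    Finset.prod_pos fun k _ => by have h0 : (0 : ℝ) ≤ k := Nat.cast_nonneg k; positivity
  rw [eq_div_iff (pow_ne_zero 2 hpos.ne'), mul_comm, ← gegenbauer_eval_one hq0 hq1 hrec ha hb hlam (n + 1), gegenbauer_discr_mul hq0 hq1 hrec ha hb hlam n]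

/-- **THE GEGENBAUER VANDERMONDE: `(∏_{i<j}(x_j − x_i))² = c_n^{n+1} ∏ b_{k+1}^{k+1} ∕ q_{n+1}(1)²`** whenever `q_{n+1} = ∏ (X − x_k)` (e.g. the ordered zeros of N390). [Stieltjes 1885; Szegő §6.7;
this file, §1174] -/
theorem gegenbauer_zeros_discr {q : ℕ → ℝ[X]} {a b : ℕ → ℝ} {lam : ℝ} (hq0 : q 0 = 1) (hq1 : q 1 = Polynomial.X - C (a 0))
    (hrec : ∀ n, q (n + 2) = (Polynomial.X - C (a (n + 1))) * q (n + 1) - C (b (n + 1)) * q n) (ha : ∀ n, a n = 0)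
    (hb : ∀ n, b (n + 1) = ((n : ℝ) + 1) * ((n : ℝ) + 2 * lam) / (4 * ((n : ℝ) + 1 + lam) * ((n : ℝ) + lam))) (hlam : 0 < lam) {n : ℕ} {x : Fin (n + 1) → ℝ}
    (hxq : q (n + 1) = ∏ k, (Polynomial.X - C (x k))) :
    (∏ i : Fin (n + 1), ∏ j ∈ Finset.Ioi i, (x j - x i)) ^ 2 = (((n : ℝ) + 1) * ((n : ℝ) + 2 * lam) / (2 * ((n : ℝ) + lam))) ^ (n + 1) * (∏ k ∈ Finset.range n, b (k + 1) ^ (k + 1)) /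
      (∏ k ∈ Finset.range (n + 1), ((k : ℝ) + 2 * lam) / (2 * ((k : ℝ) + lam))) ^ 2 := by
  rw [← discr_prod_X_sub_C ℝ x, ← hxq, gegenbauer_discr hq0 hq1 hrec ha hb hlam]

/-- **THE MONIC LEGENDRE VALUE AT `1`: `P̃_n(1) = ∏_{k<n} (k+1)∕(2k+1)`** (`= 2^n (n!)²∕(2n)!`). [Szegő (4.7.3) at `λ = ½`; this file, §1174] -/
theorem legendre_eval_one {q : ℕ → ℝ[X]} {a b : ℕ → ℝ} (hq0 : q 0 = 1) (hq1 : q 1 = Polynomial.X - C (a 0))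
    (hrec : ∀ n, q (n + 2) = (Polynomial.X - C (a (n + 1))) * q (n + 1) - C (b (n + 1)) * q n) (ha : ∀ n, a n = 0)
    (hb : ∀ n, b (n + 1) = ((n : ℝ) + 1) ^ 2 / (4 * ((n : ℝ) + 1) ^ 2 - 1)) (n : ℕ) :
    (q n).eval 1 = ∏ k ∈ Finset.range n, ((k : ℝ) + 1) / (2 * (k : ℝ) + 1) := by
  have hb' : ∀ m : ℕ, b (m + 1) = ((m : ℝ) + 1) * ((m : ℝ) + 2 * (1 / 2)) / (4 * ((m : ℝ) + 1 + 1 / 2) * ((m : ℝ) + 1 / 2)) := fun m => by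
    rw [hb]
    have h0 : (0 : ℝ) ≤ m := Nat.cast_nonneg m
    have h1 : 4 * ((m : ℝ) + 1) ^ 2 - 1 ≠ 0 := by nlinarith
    have h2 : 4 * ((m : ℝ) + 1 + 1 / 2) * ((m : ℝ) + 1 / 2) ≠ 0 := by positivity
    rw [div_eq_div_iff h1 h2]; ring
  rw [gegenbauer_eval_one hq0 hq1 hrec ha hb' (by norm_num) n]
  refine Finset.prod_congr rfl fun k _ => ?_
  have h0 : (0 : ℝ) ≤ k := Nat.cast_nonneg k
  rw [div_eq_div_iff (by positivity) (by positivity)]; ring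

/-- **LEGENDRE: `(∏_{k ≤ n} (k+1)∕(2k+1))² · disc(P̃_{n+1}) = ((n+1)²∕(2n+1))^{n+1} · ∏_{k<n} ((k+1)²∕(4(k+1)²−1))^{k+1}`** (monic `P̃`). [Stieltjes 1885; Hilbert 1888; Szegő (6.71.5) at `λ = ½`;
this file, §1174] -/
theorem legendre_discr_mul {q : ℕ → ℝ[X]} {a b : ℕ → ℝ} (hq0 : q 0 = 1) (hq1 : q 1 = Polynomial.X - C (a 0))
    (hrec : ∀ n, q (n + 2) = (Polynomial.X - C (a (n + 1))) * q (n + 1) - C (b (n + 1)) * q n) (ha : ∀ n, a n = 0)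
    (hb : ∀ n, b (n + 1) = ((n : ℝ) + 1) ^ 2 / (4 * ((n : ℝ) + 1) ^ 2 - 1)) (n : ℕ) :
    (∏ k ∈ Finset.range (n + 1), ((k : ℝ) + 1) / (2 * (k : ℝ) + 1)) ^ 2 * (q (n + 1)).discr =
      (((n : ℝ) + 1) ^ 2 / (2 * (n : ℝ) + 1)) ^ (n + 1) * ∏ k ∈ Finset.range n, (((k : ℝ) + 1) ^ 2 / (4 * ((k : ℝ) + 1) ^ 2 - 1)) ^ (k + 1) := by
  have hb' : ∀ m : ℕ, b (m + 1) = ((m : ℝ) + 1) * ((m : ℝ) + 2 * (1 / 2)) / (4 * ((m : ℝ) + 1 + 1 / 2) * ((m : ℝ) + 1 / 2)) := fun m => by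
    rw [hb]
    have h0 : (0 : ℝ) ≤ m := Nat.cast_nonneg m
    have h1 : 4 * ((m : ℝ) + 1) ^ 2 - 1 ≠ 0 := by nlinarith
    have h2 : 4 * ((m : ℝ) + 1 + 1 / 2) * ((m : ℝ) + 1 / 2) ≠ 0 := by positivity
    rw [div_eq_div_iff h1 h2]; ring
  have h := gegenbauer_discr_mul hq0 hq1 hrec ha hb' (by norm_num) n
  have h0 : (0 : ℝ) ≤ n := Nat.cast_nonneg n
  have hc : ((n : ℝ) + 1) * ((n : ℝ) + 2 * (1 / 2)) / (2 * ((n : ℝ) + 1 / 2)) = ((n : ℝ) + 1) ^ 2 / (2 * (n : ℝ) + 1) := by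
    rw [div_eq_div_iff (by positivity) (by positivity)]; ring
  rw [legendre_eval_one hq0 hq1 hrec ha hb (n + 1), hc] at h
  rw [h, Finset.prod_congr rfl fun k _ => by rw [hb k]]

end Summit.Ventures.HSemireg.Wedge.HankelOuter
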